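import Literature.Barriers.AtomisticToContinuum.HalfFillingGaussianDomination
import Literature.MathematicalPhysics.QuantumLattice.ReflectionSymmetricIceRule
import Literature.MathematicalPhysics.QuantumLattice.HardCoreBosonCheckerboardSolid
import Literature.MathematicalPhysics.QuantumLattice.HeisenbergModelGlobalRotationProofs
import Literature.MathematicalPhysics.QuantumLattice.FinDimSpectrumSectorGibbsLimit
import Literature.MathematicalPhysics.QuantumLattice.SectorSpectrum
import HarnessLib

/-!
# Hard-core lattice bosons: half filling is optimal — the absolute ground state and the maximal
# canonical partition function sit at `N = |Λ|/2` (Aizenman–Lieb–Seiringer–Solovej–Yngvason 2004, Appendix A)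

Topic `MathematicalPhysics/QuantumLattice` (hard-core boson ⇄ quantum XY dictionary, companion of
`HardCoreBosonCondensation.lean` / `HardCoreBosonCheckerboardSolid.lean`; the model is the tree's
`Literature.Barriers.AtomisticToContinuum.BoseGas.hardCoreLatticeGas d L λ` =
`-Σ_{⟨xy⟩}(S¹_xS¹_y + S²_xS²_y) + λΣ_x(½ + (-1)^xS³_x)` of [LSSY2005] (11.2), i.e. hard-core bosons with
hopping `½` in the staggered "optical lattice" potential `λ(-1)^x`, `a†_x = S⁺_x`, `n_x = S³_x + ½`).
Everything below is a THEOREM; no named fact is introduced.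

## What is printed

M. Aizenman, E. H. Lieb, R. Seiringer, J. P. Solovej, J. Yngvason, *Bose–Einstein quantum phase
transition in an optical lattice model*, Phys. Rev. A **70** (2004) 023612, Appendix A
("Half-filling and reflection positivity", = arXiv:cond-mat/0403240 §9): "we will show that `H`
has a unique ground state which has particle number `|Λ|/2` … We also establish the corresponding
result at positive temperature, namely that the canonical partition function is maximal for
particle number `N = |Λ|/2`, although we do not prove that the maximum is obtained only at
half-filling": with `Z(m) = Tr 𝒫_m exp(-βH)`, `𝒫_m` the projection onto `Σ_x S³_x = m`,
**`Z(m) ≤ Z(0)`** (A.11).  The proof: divide the (even) torus by a pair of planes, perform the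
unitary that makes `H' = H_L ⊗ I + I ⊗ H_L - ½Σ_M(S⁺S⁺ + S⁻S⁻)` real and reflection symmetric and
turns `Σ_x S³_x` into `S' = S ⊗ I - I ⊗ S`; at `T = 0` the coefficient matrix `ψ̂` of an absolute
ground state gives, by the Dyson–Lieb–Simon / Kennedy–Lieb–Shastry trace inequality, absolute ground
states `(ψ̂ψ̂†)^{1/2}`, `(ψ̂†ψ̂)^{1/2}` with `S' = 0`; at `T > 0` the Trotter expansion of
`Tr 𝒫'_m e^{-βH'}`, `𝒫'_m = Σ_n P_n ⊗ P_{n-m}`, "may be written as sums of terms of the form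
`A_nA_{n-m}`" with `A_n` real, and `A_nA_{n-m} ≤ A_n²/2 + A_{n-m}²/2`.

## What this file proves (all `d ≥ 1`, even side `L` (so `L ≥ 2`; the Kronecker bookkeeping of the
## tree needs nothing more), EVERY staggered field `λ ∈ ℝ`)

* §1 (abstract, `namespace Matrix`) **the Dyson–Lieb–Simon trace inequality WITH A REAL SEPARABLE
  INSERTION**: `Re Tr[(Σ_k P_k⊗Q_k) exp(A⊗1 + 1⊗B + ΣMᵢ⊗Nᵢ)] ≤
  (Re Tr[(Σ_k P_k⊗P_k) exp(A⊗1+1⊗A+ΣMᵢ⊗Mᵢ)])^{1/2} (Re Tr[(Σ_k Q_k⊗Q_k) exp(B⊗1+1⊗B+ΣNᵢ⊗Nᵢ)])^{1/2}`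
  for real `A, B, Mᵢ, Nᵢ, P_k, Q_k` (`Matrix.trace_mul_exp_kroneckerSum_le`; the power version
  `Matrix.trace_mul_pow_kroneckerSum_le`), by the tree's Euler-approximant route
  (`KroneckerTraceSchwarz.lean`) with Cauchy–Schwarz over (insertion index × word);
* §2 the sublattice rotation `W = ⨂_{x odd} σˣ` (`HardCoreBoson.sublatticeFlip`) maps `H` to the real
  form `H♭(0) + λΣ(½ + S³)` (staggered field ↦ uniform field, `sublatticeFlip_conj_hardCoreLatticeGas`)
  and `S³_tot` to the STAGGERED magnetisation (`sublatticeFlip_conj_totalSpin`);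
* §3 along a pair of planes the rotated Hamiltonian is the reflection-SYMMETRIC real Kronecker form
  `(A+λF)⊗1 + 1⊗(A+λF) - ΣMᵢ⊗Mᵢ` (`rotated_eq_submatrix`, from the tree's
  `xyRealFieldHamiltonian_eq_submatrix` and `uniformField_eq_embed`) and the staggered magnetisation is
  `F_ε⊗1 + 1⊗(-F_ε)` (`stagSpin_eq_submatrix`; the reflection exchanges the sublattices,
  `torusParity_reflectBetweenSites`);
* §4 **T = 0**: `exists_groundState_totalSpin_eq_zero` — there is a ground-state vector `ψ ≠ 0` of
  `hardCoreLatticeGas d L λ` with `S³_tot ψ = 0` (from the tree's positive DLS/KLS ground state and its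
  overlap with the canonical vector, `Matrix.liebSchupp_exists_groundState_annihilated`, transported
  back along `W` and the half-torus splitting); hence `lowestEnergyInSector_zero_eq_groundEnergy`
  (`E(S³_tot = 0) = E₀`), `lowestEnergyInSector_zero_le` (`E(0) ≤ E(M)` for every nonempty sector),
  and in boson language `exists_groundState_halfFilling` (`Nψ = (|Λ|/2)ψ`, with
  `sum_num_eq_totalSpin_add : Σ_x n_x = S³_tot + |Λ|/2`); `U(1)` symmetry
  `commute_xxzHamiltonian_totalSpin_two`, `commute_hardCoreLatticeGas_totalSpin`;
* §5 the magnetisation sectors: `twiceMagnetization σ = Σ_x(1 - 2σ_x)` (`= 2N - |Λ|`),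
  `sectorProj m = 𝒫_m` (diagonal), `sectorPartitionFn β H m = Re Tr 𝒫_m e^{-βH}`,
  `two_smul_totalSpin_two_eq_diagonal`, `two_smul_totalSpin_mulVec_of_sectorProj` (the range of `𝒫_m`
  is the sector `2S³_tot = m`); the rotation is a permutation matrix (`sublatticeFlip_apply`,
  `sublatticeFlip_conj_diagonal`) and `W𝒫_mWᴴ = 𝒫'_m` (`sublatticeFlip_conj_sectorProj`), and along the
  planes `𝒫'_m = Σ_n P_n ⊗ P_{n-m}` (`stagSectorProj_eq_submatrix`), whence the Kronecker form of
  `Z(m)` (`sectorPartitionFn_eq_kronecker`);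
* §6 **T > 0**: **`sectorPartitionFn_le_halfFilling`** — `Z(m) ≤ Z(0)` for every `m`, `β > 0`, `λ`
  ([AizenmanEtAl2004] (A.11)).

## What is NOT proved here

Uniqueness of the ground state and the statement that EVERY absolute ground state has
`S³_tot = 0` (the Perron–Frobenius half of the printed Appendix A) — `TODO(uniqueness)`: it needs
Perron–Frobenius in each magnetisation sector for the XY ferromagnet (the tree's
`PerronFrobeniusGroundState` machinery, cf. `LiebMattisSectorPF` for the antiferromagnet) plus the
polar-decomposition step.  Strict maximality of `Z` at half filling is not claimed in print either.

## References

* [AizenmanEtAl2004] M. Aizenman, E. H. Lieb, R. Seiringer, J. P. Solovej, J. Yngvason, Phys. Rev.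
  A 70 (2004) 023612 = arXiv:cond-mat/0403240, Appendix A (read: pp. 18–19 of the held text,
  eqs. (A.8)–(A.11) = `eq:S'=0`, `eq:reflectionpositivity`, `eq:maxpart`).
* [LSSY2005] E. H. Lieb, R. Seiringer, J. P. Solovej, J. Yngvason, *The Mathematics of the Bose Gas
  and its Condensation* (2005), Ch. 11, (11.2)–(11.4), (11.13)–(11.19).
* [DLS1978] F. J. Dyson, E. H. Lieb, B. Simon, J. Stat. Phys. 18 (1978) 335–383, Lemma 4.1 (45)–(47).
* [KLS1988JSP] T. Kennedy, E. H. Lieb, B. S. Shastry, J. Stat. Phys. 53 (1988) 1019, eqs. (15)–(25).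
* [LiebSchupp2000] E. H. Lieb, P. Schupp, Physica A 279 (2000) 378, §5 (projection of the canonical
  vector onto the ground space).
* [FrohlichLieb1978] J. Fröhlich, E. H. Lieb, Commun. Math. Phys. 60 (1978) 233, eq. (1.4a) (the
  sublattice rotation).
* [Tasaki2020] H. Tasaki, *Physics and Mathematics of Quantum Many-Body Systems* (2020), §§2.1–2.5.
* [MatsubaraMatsuda1956] T. Matsubara, H. Matsuda, Prog. Theor. Phys. 16 (1956) 569, §2.
-/

noncomputable section

open NormedSpace Filter Topology Finset
open scoped Kronecker ComplexOrder

/-! ## §1 The Dyson–Lieb–Simon trace inequality with a sector insertion -/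

namespace Matrix

open Literature.MathematicalPhysics.QuantumLattice

variable {m n : Type*} [Fintype m] [Fintype n] [DecidableEq m] [DecidableEq n]

/-- Expansion of `Tr[(Σ_k P_k⊗Q_k)(Σₐ Xₐ⊗Yₐ)^N]` into weighted words:
`Σ_{k,c} Tr(P_k X_{c₀}⋯X_{c_{N-1}}) · Tr(Q_k Y_{c₀}⋯Y_{c_{N-1}})` ([DLS1978] (47)).
[cite: DLS1978, Lemma 4.1 eq. (47)] -/
theorem re_trace_mul_pow_kroneckerSum_eq {C κ : Type*} [Fintype C] [Fintype κ]
    (P : κ → Matrix m m ℂ) (Q : κ → Matrix n n ℂ) (X : C → Matrix m m ℂ) (Y : C → Matrix n n ℂ)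
    (N : ℕ) :
    (((∑ k, P k ⊗ₖ Q k) * (∑ a, X a ⊗ₖ Y a) ^ N).trace).re =
      ∑ kc : κ × (Fin N → C), ((P kc.1 * (List.ofFn fun i => X (kc.2 i)).prod).trace *
        (Q kc.1 * (List.ofFn fun i => Y (kc.2 i)).prod).trace).re := by
  rw [sum_pow_eq_sum_ofFn_prod, Finset.sum_mul_sum, ← Finset.univ_product_univ,
    ← Finset.sum_product', trace_sum, Complex.re_sum]
  refine sum_congr rfl fun kc _ => ?_
  rw [ofFn_prod_kronecker, ← mul_kronecker_mul, trace_kronecker]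

/-- `W ↦ Re Tr(S W)` is continuous. [folklore] -/
private theorem continuous_re_trace_mul {p : Type*} [Fintype p] (S : Matrix p p ℂ) :
    Continuous fun W : Matrix p p ℂ => (S * W).trace.re :=
  Complex.continuous_re.comp
    (((Matrix.traceLinearMap p ℂ ℂ).continuous_of_finiteDimensional).comp
      ((LinearMap.mulLeft ℂ S).continuous_of_finiteDimensional))

/-- **Trace Schwarz inequality for separable sums with a separable insertion** (the algebraic
core of [AizenmanEtAl2004] App. A, proof of (A.11): "the trace … may be written as sums of terms
of the form `A_n A_{n-m}` … Since `A_n` is real … `A_n A_{n-m} ≤ A_n²/2 + A_{n-m}²/2`"; here in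
Cauchy–Schwarz form, generalising [DLS1978] Lemma 4.1 / the tree's
`Matrix.trace_pow_kroneckerSum_le`): for finite families of REAL square matrices `Xₐ, P_k`
(size `m`) and `Yₐ, Q_k` (size `n`) and every `N`,
`Re Tr[(Σ_k P_k⊗Q_k)(Σₐ Xₐ⊗Yₐ)^N] ≤ (Re Tr[(Σ_k P_k⊗P_k)(Σₐ Xₐ⊗Xₐ)^N])^{1/2} (Re Tr[(Σ_k Q_k⊗Q_k)(Σₐ Yₐ⊗Yₐ)^N])^{1/2}`.
[cite: AizenmanEtAl2004, Appendix A (proof of (A.11))] [cite: DLS1978, Lemma 4.1] -/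
theorem trace_mul_pow_kroneckerSum_le {C κ : Type*} [Fintype C] [Fintype κ]
    {X : C → Matrix m m ℂ} {Y : C → Matrix n n ℂ} {P : κ → Matrix m m ℂ} {Q : κ → Matrix n n ℂ}
    (hX : ∀ a, (X a)ᵀ = (X a)ᴴ) (hY : ∀ a, (Y a)ᵀ = (Y a)ᴴ)
    (hP : ∀ k, (P k)ᵀ = (P k)ᴴ) (hQ : ∀ k, (Q k)ᵀ = (Q k)ᴴ) (N : ℕ) :
    (((∑ k, P k ⊗ₖ Q k) * (∑ a, X a ⊗ₖ Y a) ^ N).trace).re ≤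
      Real.sqrt (((∑ k, P k ⊗ₖ P k) * (∑ a, X a ⊗ₖ X a) ^ N).trace).re *
        Real.sqrt (((∑ k, Q k ⊗ₖ Q k) * (∑ a, Y a ⊗ₖ Y a) ^ N).trace).re := by
  -- the real traces of the weighted words
  set p : κ × (Fin N → C) → ℝ :=
    fun kc => ((P kc.1 * (List.ofFn fun i => X (kc.2 i)).prod).trace).re with hp
  set q : κ × (Fin N → C) → ℝ :=
    fun kc => ((Q kc.1 * (List.ofFn fun i => Y (kc.2 i)).prod).trace).re with hq
  have hpC : ∀ kc : κ × (Fin N → C),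
      (P kc.1 * (List.ofFn fun i => X (kc.2 i)).prod).trace = (p kc : ℂ) := fun kc =>
    trace_eq_ofReal_re_of_transpose_eq_conjTranspose
      (transpose_eq_conjTranspose_mul (hP kc.1)
        (ofFn_prod_transpose_eq_conjTranspose fun i => hX (kc.2 i)))
  have hqC : ∀ kc : κ × (Fin N → C),
      (Q kc.1 * (List.ofFn fun i => Y (kc.2 i)).prod).trace = (q kc : ℂ) := fun kc =>
    trace_eq_ofReal_re_of_transpose_eq_conjTranspose
      (transpose_eq_conjTranspose_mul (hQ kc.1)
        (ofFn_prod_transpose_eq_conjTranspose fun i => hY (kc.2 i)))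
  have hXY : (((∑ k, P k ⊗ₖ Q k) * (∑ a, X a ⊗ₖ Y a) ^ N).trace).re =
      ∑ kc : κ × (Fin N → C), p kc * q kc := by
    rw [re_trace_mul_pow_kroneckerSum_eq]
    refine sum_congr rfl fun kc _ => ?_
    rw [hpC, hqC, ← Complex.ofReal_mul, Complex.ofReal_re]
  have hXX : (((∑ k, P k ⊗ₖ P k) * (∑ a, X a ⊗ₖ X a) ^ N).trace).re =
      ∑ kc : κ × (Fin N → C), p kc * p kc := by
    rw [re_trace_mul_pow_kroneckerSum_eq]
    refine sum_congr rfl fun kc _ => ?_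
    rw [hpC, ← Complex.ofReal_mul, Complex.ofReal_re]
  have hYY : (((∑ k, Q k ⊗ₖ Q k) * (∑ a, Y a ⊗ₖ Y a) ^ N).trace).re =
      ∑ kc : κ × (Fin N → C), q kc * q kc := by
    rw [re_trace_mul_pow_kroneckerSum_eq]
    refine sum_congr rfl fun kc _ => ?_
    rw [hqC, ← Complex.ofReal_mul, Complex.ofReal_re]
  rw [hXY, hXX, hYY]
  -- Cauchy–Schwarz
  have hCS := Finset.sum_mul_sq_le_sq_mul_sq (univ : Finset (κ × (Fin N → C))) p q
  have hpp : 0 ≤ ∑ kc : κ × (Fin N → C), p kc * p kc := sum_nonneg fun c _ => mul_self_nonneg _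
  calc ∑ kc : κ × (Fin N → C), p kc * q kc ≤ |∑ kc : κ × (Fin N → C), p kc * q kc| := le_abs_self _
    _ ≤ Real.sqrt ((∑ kc : κ × (Fin N → C), p kc * p kc) * ∑ kc : κ × (Fin N → C), q kc * q kc) := by
        refine Real.abs_le_sqrt ?_
        simpa only [sq] using hCS
    _ = Real.sqrt (∑ kc : κ × (Fin N → C), p kc * p kc) *
          Real.sqrt (∑ kc : κ × (Fin N → C), q kc * q kc) := Real.sqrt_mul hpp _

section Exp

variable [Nonempty m] [Nonempty n]

/-- **The Dyson–Lieb–Simon trace inequality with a separable real insertion** (limit `N → ∞` of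
`trace_mul_pow_kroneckerSum_le` along the Euler approximants of the tree's
`Matrix.tendsto_approximant_pow`): for REAL square matrices `A, Mᵢ, P_k` (size `m`) and
`B, Nᵢ, Q_k` (size `n`),
`Re Tr[(Σ_k P_k⊗Q_k) exp(A⊗1 + 1⊗B + ΣᵢMᵢ⊗Nᵢ)] ≤ (Re Tr[(Σ_k P_k⊗P_k) exp(A⊗1 + 1⊗A + ΣᵢMᵢ⊗Mᵢ)])^{1/2}
(Re Tr[(Σ_k Q_k⊗Q_k) exp(B⊗1 + 1⊗B + ΣᵢNᵢ⊗Nᵢ)])^{1/2}` — the inequality behind "the canonical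
partition function is maximal at half filling" ([AizenmanEtAl2004] (A.11), there via the Trotter
formula with the insertion `𝒫'_m = Σ_n P_n ⊗ P_{n-m}`).
[cite: AizenmanEtAl2004, Appendix A (A.11)] [cite: DLS1978, Lemma 4.1] -/
theorem trace_mul_exp_kroneckerSum_le {ι κ : Type*} [Fintype ι] [Fintype κ] {A : Matrix m m ℂ}
    {B : Matrix n n ℂ} {M : ι → Matrix m m ℂ} {Nn : ι → Matrix n n ℂ}
    {P : κ → Matrix m m ℂ} {Q : κ → Matrix n n ℂ} (hA : Aᵀ = Aᴴ)
    (hB : Bᵀ = Bᴴ) (hM : ∀ i, (M i)ᵀ = (M i)ᴴ) (hN : ∀ i, (Nn i)ᵀ = (Nn i)ᴴ)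
    (hP : ∀ k, (P k)ᵀ = (P k)ᴴ) (hQ : ∀ k, (Q k)ᵀ = (Q k)ᴴ) :
    ((∑ k, P k ⊗ₖ Q k) *
        exp (A ⊗ₖ (1 : Matrix n n ℂ) + (1 : Matrix m m ℂ) ⊗ₖ B + ∑ i, M i ⊗ₖ Nn i)).trace.re ≤
      Real.sqrt ((∑ k, P k ⊗ₖ P k) * exp (A ⊗ₖ (1 : Matrix m m ℂ) + (1 : Matrix m m ℂ) ⊗ₖ A +
          ∑ i, M i ⊗ₖ M i)).trace.re *
        Real.sqrt ((∑ k, Q k ⊗ₖ Q k) * exp (B ⊗ₖ (1 : Matrix n n ℂ) + (1 : Matrix n n ℂ) ⊗ₖ B +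
          ∑ i, Nn i ⊗ₖ Nn i)).trace.re := by
  -- the approximating families (as in `Matrix.trace_exp_kroneckerSum_le`)
  set X : ℕ → Option ι → Matrix m m ℂ := fun N a =>
    Option.elim a ((1 : Matrix m m ℂ) + ((N : ℂ))⁻¹ • A) (fun i => (((Real.sqrt N)⁻¹ : ℝ) : ℂ) • M i)
    with hXdef
  set Y : ℕ → Option ι → Matrix n n ℂ := fun N a =>
    Option.elim a ((1 : Matrix n n ℂ) + ((N : ℂ))⁻¹ • B) (fun i => (((Real.sqrt N)⁻¹ : ℝ) : ℂ) • Nn i)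
    with hYdef
  have hX : ∀ N a, (X N a)ᵀ = (X N a)ᴴ := by
    intro N a
    rcases a with _ | i
    · exact transpose_eq_conjTranspose_one_add_inv_smul hA N
    · exact transpose_eq_conjTranspose_ofReal_smul' (hM i) _
  have hY : ∀ N a, (Y N a)ᵀ = (Y N a)ᴴ := by
    intro N a
    rcases a with _ | i
    · exact transpose_eq_conjTranspose_one_add_inv_smul hB N
    · exact transpose_eq_conjTranspose_ofReal_smul' (hN i) _
  have hineq : ∀ N : ℕ, (((∑ k, P k ⊗ₖ Q k) * (∑ a, X N a ⊗ₖ Y N a) ^ N).trace).re ≤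
      Real.sqrt (((∑ k, P k ⊗ₖ P k) * (∑ a, X N a ⊗ₖ X N a) ^ N).trace).re *
        Real.sqrt (((∑ k, Q k ⊗ₖ Q k) * (∑ a, Y N a ⊗ₖ Y N a) ^ N).trace).re :=
    fun N => trace_mul_pow_kroneckerSum_le (hX N) (hY N) hP hQ N
  -- the three limits
  have hXY : Tendsto (fun N : ℕ => (((∑ k, P k ⊗ₖ Q k) * (∑ a, X N a ⊗ₖ Y N a) ^ N).trace).re) atTop
      (𝓝 ((∑ k, P k ⊗ₖ Q k) *
        exp (A ⊗ₖ (1 : Matrix n n ℂ) + (1 : Matrix m m ℂ) ⊗ₖ B + ∑ i, M i ⊗ₖ Nn i)).trace.re) := by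
    have h := tendsto_approximant_pow A B M Nn
    have h2 := ((continuous_re_trace_mul (∑ k, P k ⊗ₖ Q k)).tendsto _).comp h
    refine h2.congr fun N => ?_
    simp only [Function.comp_apply, hXdef, hYdef, sum_option_kronecker_approximant]
  have hXX : Tendsto (fun N : ℕ =>
      Real.sqrt (((∑ k, P k ⊗ₖ P k) * (∑ a, X N a ⊗ₖ X N a) ^ N).trace).re) atTop
      (𝓝 (Real.sqrt ((∑ k, P k ⊗ₖ P k) * exp (A ⊗ₖ (1 : Matrix m m ℂ) + (1 : Matrix m m ℂ) ⊗ₖ A +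
        ∑ i, M i ⊗ₖ M i)).trace.re)) := by
    have h := tendsto_approximant_pow A A M M
    have h2 := ((Real.continuous_sqrt.comp (continuous_re_trace_mul (∑ k, P k ⊗ₖ P k))).tendsto _).comp h
    refine h2.congr fun N => ?_
    simp only [Function.comp_apply, hXdef, sum_option_kronecker_approximant]
  have hYY : Tendsto (fun N : ℕ =>
      Real.sqrt (((∑ k, Q k ⊗ₖ Q k) * (∑ a, Y N a ⊗ₖ Y N a) ^ N).trace).re) atTop
      (𝓝 (Real.sqrt ((∑ k, Q k ⊗ₖ Q k) * exp (B ⊗ₖ (1 : Matrix n n ℂ) + (1 : Matrix n n ℂ) ⊗ₖ B +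
        ∑ i, Nn i ⊗ₖ Nn i)).trace.re)) := by
    have h := tendsto_approximant_pow B B Nn Nn
    have h2 := ((Real.continuous_sqrt.comp (continuous_re_trace_mul (∑ k, Q k ⊗ₖ Q k))).tendsto _).comp h
    refine h2.congr fun N => ?_
    simp only [Function.comp_apply, hYdef, sum_option_kronecker_approximant]
  exact le_of_tendsto_of_tendsto' hXY (hXX.mul hYY) hineq

end Exp

end Matrix


/-! ## §2 The sublattice rotation of the hard-core lattice gas and of the particle number -/

namespace Literature.MathematicalPhysics.QuantumLattice

namespace HardCoreBoson

open Matrix Literature.Probability.LatticeModels Literature.Barriers.AtomisticToContinuum.BoseGas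

variable {d : ℕ} {L : ℕ} [NeZero L]

/-- On an even torus the staggered sign `(-1)^{Σᵢ xᵢ}` of [LSSY2005] (11.2) (canonical
representatives) is the sublattice sign `ε_x` (`+1` on even, `-1` on odd sites).
[cite: LSSY2005, Ch. 11 (11.2)] -/
theorem neg_one_pow_sum_val_eq_ite (x : TorusSite d L) :
    ((-1 : ℂ) ^ (∑ i, (x i).val)) = if torusParity L x = 1 then -1 else 1 := by
  have hcast : torusParity L x = ((∑ i, (x i).val : ℕ) : ZMod 2) := by
    rw [torusParity, Nat.cast_sum]
    refine Finset.sum_congr rfl fun i _ => ?_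
    rw [ZMod.cast_eq_val]
  rw [hcast]
  by_cases ho : Odd (∑ i, (x i).val)
  · rw [if_pos ((ZMod.natCast_eq_one_iff_odd).2 ho), ho.neg_one_pow]
  · rw [if_neg (fun h => ho ((ZMod.natCast_eq_one_iff_odd).1 h)),
      (Nat.not_odd_iff_even.1 ho).neg_one_pow]

omit [NeZero L] in
/-- The sublattice sign squares to one. [folklore] -/
private theorem stagSign_mul_self (x : TorusSite d L) :
    ((if torusParity L x = 1 then -1 else 1 : ℂ)) * (if torusParity L x = 1 then -1 else 1 : ℂ) = 1 := by
  split_ifs <;> norm_num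

omit [NeZero L] in
/-- The reflection between sites flips the sublattice parity (even torus): `ε(θx) = ε(x) + 1`.
[cite: DLS1978, §2] -/
theorem torusParity_reflectBetweenSites (h2 : 2 ∣ L) (j : Fin d) (a : ZMod L) (x : TorusSite d L) :
    torusParity L (Torus.reflectBetweenSites j a x) = torusParity L x + 1 := by
  have hθ : (Torus.reflectBetweenSites j a x : TorusSite d L) = Function.update x j (2 * a + 1 - x j) := rfl
  rw [torusParity, torusParity, hθ]
  have hupd : (fun i => (ZMod.cast (Function.update x j (2 * a + 1 - x j) i) : ZMod 2)) =
      Function.update (fun i => (ZMod.cast (x i) : ZMod 2)) j (ZMod.cast (2 * a + 1 - x j)) := by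
    funext i
    by_cases hi : i = j
    · subst hi; simp
    · simp [Function.update_of_ne hi]
  rw [show (∑ i, (ZMod.cast (Function.update x j (2 * a + 1 - x j) i) : ZMod 2)) =
      ∑ i, Function.update (fun i => (ZMod.cast (x i) : ZMod 2)) j (ZMod.cast (2 * a + 1 - x j)) i
      from by rw [hupd], Finset.sum_update_of_mem (Finset.mem_univ j),
    ← Finset.add_sum_erase _ _ (Finset.mem_univ j), Finset.sdiff_singleton_eq_erase]
  have hc : (ZMod.cast (2 * a + 1 - x j) : ZMod 2) = (ZMod.cast (x j) : ZMod 2) + 1 := by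
    have h := map_sub (ZMod.castHom h2 (ZMod 2)) (2 * a + 1) (x j)
    rw [map_add, map_mul, map_one, map_ofNat] at h
    simp only [ZMod.castHom_apply] at h
    rw [h]
    have : ∀ u v : ZMod 2, 2 * u + 1 - v = v + 1 := by decide
    exact this _ _
  rw [hc]
  abel

/-- **The rotated hard-core lattice gas**: the sublattice rotation `W = ⨂_{x odd} σˣ_x`
(`HardCoreBoson.sublatticeFlip`, [LSSY2005] (11.4) / [KLS1988JSP] (15)–(16)) maps
`H = H_XY + λΣ_x(½ + (-1)^xS³_x)` to the real form `H♭(0) + λΣ_x(½ + S³_x)`: the XY part becomes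
`xyRealFieldHamiltonian L 1 0 = Σ_{⟨xy⟩}(-S¹_xS¹_y + S²_xS²_y)` and the STAGGERED field becomes
UNIFORM. (Even side `L ≥ 3`, i.e. `L ≥ 4`.) [cite: LSSY2005, Ch. 11 (11.2)–(11.4)]
[cite: AizenmanEtAl2004, Appendix A] -/
theorem sublatticeFlip_conj_hardCoreLatticeGas (h2 : 2 ∣ L) (lam : ℝ) :
    sublatticeFlip (d := d) L * hardCoreLatticeGas d L lam * (sublatticeFlip (d := d) L)ᴴ =
      xyRealFieldHamiltonian L 1 0 + (lam : ℂ) • ∑ x : TorusSite d L,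
        ((1 / 2 : ℂ) • (1 : Op (TorusSite d L) 2) + siteSpin 1 x 2) := by
  set W := sublatticeFlip (d := d) L with hW
  have hWW : W * Wᴴ = 1 := sublatticeFlip_mul_conjTranspose
  have hu : ∀ z : TorusSite d L, (if torusParity L z = 1 then spinHalfPauli 0 else
      (1 : Matrix (Fin 2) (Fin 2) ℂ))ᴴ * (if torusParity L z = 1 then spinHalfPauli 0 else 1) = 1 := by
    intro z
    split_ifs
    · ext i j
      fin_cases i <;> fin_cases j <;> simp [spinHalfPauli, Matrix.conjTranspose, Matrix.mul_apply]
    · simp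
  -- conjugation of a bond `S^α_x S^α_y` of nearest neighbours
  have hbond : ∀ {x y : TorusSite d L}, (torusGraph d L).Adj x y → ∀ α : Fin 3,
      W * (siteSpin 1 x α * siteSpin 1 y α) * Wᴴ =
        (if α = 0 then (1 : ℂ) else -1) • (siteSpin 1 x α * siteSpin 1 y α) := by
    intro x y hxy α
    have hpar := torusParity_of_adj h2 hxy
    have hsign : (if torusParity L x = 1 ∧ α ≠ 0 then (-1 : ℂ) else 1) *
        (if torusParity L y = 1 ∧ α ≠ 0 then (-1 : ℂ) else 1) = if α = 0 then 1 else -1 := by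
      rw [hpar]
      have hcases : ∀ u : ZMod 2, (u = 1 ∧ ¬ (u + 1 = 1)) ∨ (¬ u = 1 ∧ u + 1 = 1) := by decide
      rcases hcases (torusParity L x) with ⟨h1, h2'⟩ | ⟨h1, h2'⟩ <;> by_cases hα : α = 0 <;>
        simp [h1, h2', hα]
    rw [hW, sublatticeFlip, productOp_conj_mul hu, ← sublatticeFlip, sublatticeFlip_conj_siteSpin,
      sublatticeFlip_conj_siteSpin, Matrix.smul_mul, Matrix.mul_smul, smul_smul, hsign]
  have hspinBond : ∀ {x y : TorusSite d L}, (torusGraph d L).Adj x y → ∀ α : Fin 3,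
      W * spinBond 1 α x y * Wᴴ = (if α = 0 then (1 : ℂ) else -1) • spinBond 1 α x y := by
    intro x y hxy α
    rw [spinBond, Matrix.mul_smul, Matrix.smul_mul, Matrix.mul_add, Matrix.add_mul, hbond hxy,
      hbond hxy.symm, ← smul_add, smul_comm, ← spinBond]
  -- the XY part
  have hXY : W * xyTorus d L 1 * Wᴴ = xyRealFieldHamiltonian L 1 0 := by
    rw [xyTorus, xxzHamiltonian, xyRealFieldHamiltonian, Matrix.mul_smul, Matrix.smul_mul,
      Finset.mul_sum, Finset.sum_mul, Finset.smul_sum]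
    refine Finset.sum_congr rfl fun e he => ?_
    induction e using Sym2.ind with
    | h x y =>
      rw [SimpleGraph.mem_edgeFinset, SimpleGraph.mem_edgeSet] at he
      simp only [Sym2.lift_mk, Matrix.mul_add, Matrix.add_mul, Matrix.mul_smul, Matrix.smul_mul,
        hspinBond he, xyRealBond]
      simp only [Fin.isValue, ↓reduceIte, one_smul, one_ne_zero, Fin.reduceEq, Complex.ofReal_zero,
        zero_smul, smul_zero, add_zero, Pi.zero_apply, sub_self, sub_zero, ne_eq, OfNat.ofNat_ne_zero,
        not_false_eq_true, zero_pow, zero_div, smul_add, smul_neg, neg_smul, one_smul]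
      norm_num
  -- the staggered field
  have hWz : ∀ x : TorusSite d L, W * siteSpin 1 x 2 * Wᴴ =
      (if torusParity L x = 1 then (-1 : ℂ) else 1) • siteSpin 1 x 2 := by
    intro x
    rw [hW, sublatticeFlip_conj_siteSpin]
    congr 1
    by_cases hx : torusParity L x = 1 <;> simp [hx]
  have hF : W * (∑ x : TorusSite d L, ((1 / 2 : ℂ) • (1 : Op (TorusSite d L) 2) +
      ((-1 : ℂ) ^ (∑ i, (x i).val)) • siteSpin 1 x 2)) * Wᴴ =
      ∑ x : TorusSite d L, ((1 / 2 : ℂ) • (1 : Op (TorusSite d L) 2) + siteSpin 1 x 2) := by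
    rw [Finset.mul_sum, Finset.sum_mul]
    refine Finset.sum_congr rfl fun x _ => ?_
    rw [Matrix.mul_add, Matrix.add_mul, Matrix.mul_smul, Matrix.smul_mul, Matrix.mul_one, hWW,
      Matrix.mul_smul, Matrix.smul_mul, hWz, smul_smul, neg_one_pow_sum_val_eq_ite,
      stagSign_mul_self, one_smul]
  rw [hardCoreLatticeGas_eq, Matrix.mul_add, Matrix.add_mul, hXY, Matrix.mul_smul, Matrix.smul_mul, hF]

/-- **The rotated particle number**: `W (Σ_x S³_x) Wᴴ = Σ_x ε_x S³_x` — under the sublattice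
rotation the total magnetisation `S³_tot = N - |Λ|/2` (`HardCoreBoson.num_eq`) becomes the
STAGGERED magnetisation. [cite: AizenmanEtAl2004, Appendix A] -/
theorem sublatticeFlip_conj_totalSpin :
    sublatticeFlip (d := d) L * totalSpin 1 2 * (sublatticeFlip (d := d) L)ᴴ =
      ∑ x : TorusSite d L, (if torusParity L x = 1 then (-1 : ℂ) else 1) • siteSpin 1 x 2 := by
  rw [totalSpin, Finset.mul_sum, Finset.sum_mul]
  refine Finset.sum_congr rfl fun x _ => ?_
  rw [sublatticeFlip_conj_siteSpin]
  congr 1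
  by_cases hx : torusParity L x = 1 <;> simp [hx]

/-! ## §3 Kronecker forms along a pair of planes -/

section Kronecker

variable (L) (j : Fin d) (a : ZMod L) (hL : Even L)

/-- The staggered magnetisation of the LEFT half, `F_ε = Σ_{s ∈ Λ_L} ε_s S³_s` (a real diagonal
matrix on the state space of the left half). [cite: AizenmanEtAl2004, Appendix A] -/
def leftStagSpin : Op (torusLeftHalf L j a) 2 :=
  ∑ s : torusLeftHalf L j a, (if torusParity L (s : TorusSite d L) = 1 then (-1 : ℂ) else 1) •
    siteSpin 1 s 2

/-- The uniform field of the left half, `F = Σ_{s ∈ Λ_L} (½ + S³_s)` (as in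
`HalfFillingGaussianDomination`). [cite: LSSY2005, Ch. 11 (11.13)] -/
def leftUniformField : Op (torusLeftHalf L j a) 2 :=
  ∑ s : torusLeftHalf L j a, ((((1 / 2 : ℝ)) : ℂ) • (1 : Op (torusLeftHalf L j a) 2) + siteSpin 1 s 2)

variable {L j a}

/-- `F_ε` is a real symmetric matrix: `F_εᵀ = F_ε` ([AizenmanEtAl2004] App. A: "The operator `S` is
represented by a real symmetric matrix in the standard basis"). [cite: AizenmanEtAl2004, Appendix A] -/
theorem leftStagSpin_transpose : (leftStagSpin L j a)ᵀ = leftStagSpin L j a := by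
  rw [leftStagSpin, transpose_sum]
  refine Finset.sum_congr rfl fun s _ => ?_
  rw [transpose_smul, siteSpin_two_transpose_eq, (siteSpin_isHermitian 1 s 2).eq]

/-- `F_ε` is Hermitian. [cite: AizenmanEtAl2004, Appendix A] -/
theorem leftStagSpin_isHermitian : (leftStagSpin L j a).IsHermitian := by
  refine (isSelfAdjoint_sum _ fun s _ => ?_).isHermitian
  refine IsHermitian.isSelfAdjoint (IsHermitian.smul (siteSpin_isHermitian 1 s 2) ?_)
  rw [isSelfAdjoint_iff]
  split_ifs <;> simp

omit [NeZero L] in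
/-- Reindexing is additive (pointwise form of `Matrix.submatrix_add`). [folklore] -/
private theorem submatrix_add' {p q : Type*} (A B : Matrix q q ℂ) (e : p → q) :
    (A + B).submatrix e e = A.submatrix e e + B.submatrix e e := rfl

omit [NeZero L] in
/-- Reindexing commutes with scalars (pointwise form of `Matrix.submatrix_smul`). [folklore] -/
private theorem submatrix_smul' {p q : Type*} (c : ℂ) (A : Matrix q q ℂ) (e : p → q) :
    (c • A).submatrix e e = c • A.submatrix e e := rfl

omit [NeZero L] in
/-- `A ⊗ (-B) = -(A ⊗ B)`. [folklore] -/
private theorem kronecker_neg' {p q : Type*} (A : Matrix p p ℂ) (B : Matrix q q ℂ) :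
    A ⊗ₖ (-B) = -(A ⊗ₖ B) := by
  ext ⟨i, k⟩ ⟨i', k'⟩
  simp [Matrix.kroneckerMap_apply]

/-- **The staggered magnetisation is `F_ε ⊗ 1 - 1 ⊗ F_ε`** along the planes `xⱼ = a + ½`,
`xⱼ = a + ½ + L/2` (the reflection exchanges the sublattices, `torusParity_reflectBetweenSites`):
the Kronecker form `X ⊗ 1 + 1 ⊗ Y` with `Yᵀ = -X` of [LiebSchupp2000] §5 / [AizenmanEtAl2004]
App. A (`S' = S ⊗ I - I ⊗ S`). [cite: AizenmanEtAl2004, Appendix A] -/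
theorem stagSpin_eq_submatrix :
    (∑ x : TorusSite d L, (if torusParity L x = 1 then (-1 : ℂ) else 1) • siteSpin 1 x 2) =
      (leftStagSpin L j a ⊗ₖ (1 : Op (torusLeftHalf L j a) 2) +
        (1 : Op (torusLeftHalf L j a) 2) ⊗ₖ (-leftStagSpin L j a)).submatrix
        (torusSplit L j a hL) (torusSplit L j a hL) := by
  have h2 : 2 ∣ L := even_iff_two_dvd.1 hL
  rw [sum_sites_split L j a hL, submatrix_add', ← torusLeftEmbed_apply, ← torusRightEmbed_apply,
    map_neg, leftStagSpin, map_sum, map_sum, ← Finset.sum_coe_sort (torusLeftHalf L j a),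
    ← Finset.sum_coe_sort (torusLeftHalf L j a), ← Finset.sum_neg_distrib]
  congr 1
  · refine Finset.sum_congr rfl fun s _ => ?_
    rw [map_smul, siteSpin_eq_torusLeftEmbed (hL := hL) 1 s.2, torusToLeft_of_mem L j a hL s.2]
  · refine Finset.sum_congr rfl fun s _ => ?_
    have hs' : Torus.reflectBetweenSites j a (s : TorusSite d L) ∉ torusLeftHalf L j a := fun h =>
      (reflectBetweenSites_mem_torusLeftHalf_iff L j a hL (s : TorusSite d L)).1 h s.2
    rw [map_smul, siteSpin_eq_torusRightEmbed (hL := hL) 1 hs', torusToLeft_reflectBetweenSites,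
      torusToLeft_of_mem L j a hL s.2, torusParity_reflectBetweenSites h2, ← neg_smul]
    congr 1
    have hcases : ∀ u : ZMod 2, (u = 1 ∧ ¬ (u + 1 = 1)) ∨ (¬ u = 1 ∧ u + 1 = 1) := by decide
    rcases hcases (torusParity L (s : TorusSite d L)) with ⟨h1, h1'⟩ | ⟨h1, h1'⟩ <;> simp [h1, h1']

/-- **The rotated hard-core gas is `(A + λF) ⊗ 1 + 1 ⊗ (A + λF) - Σᵢ Mᵢ ⊗ Mᵢ`** with
`A = xyLeftHamiltonian … 0`, `Mᵢ = xyCrossOp … 0` (the tree's KLS Kronecker form of `H♭(0)`,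
`xyRealFieldHamiltonian_eq_submatrix`) and `F` the uniform field of the left half
(`uniformField_eq_embed`) — reflection-SYMMETRIC, all matrices real.
[cite: LSSY2005, Ch. 11 (11.13)] [cite: KLS1988JSP, eq. (21)] -/
theorem rotated_eq_submatrix (lam : ℝ) :
    xyRealFieldHamiltonian L 1 0 + (lam : ℂ) • ∑ x : TorusSite d L,
        ((1 / 2 : ℂ) • (1 : Op (TorusSite d L) 2) + siteSpin 1 x 2) =
      ((xyLeftHamiltonian L j a hL 1 0 + (lam : ℂ) • leftUniformField L j a) ⊗ₖ
          (1 : Op (torusLeftHalf L j a) 2) +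
        (1 : Op (torusLeftHalf L j a) 2) ⊗ₖ
          (xyLeftHamiltonian L j a hL 1 0 + (lam : ℂ) • leftUniformField L j a) -
        ∑ i, xyCrossOp L j a hL 1 0 i ⊗ₖ xyCrossOp L j a hL 1 0 i).submatrix
        (torusSplit L j a hL) (torusSplit L j a hL) := by
  have h12 : ((1 / 2 : ℝ) : ℂ) = 1 / 2 := by push_cast; ring
  have hU : (∑ x : TorusSite d L, ((1 / 2 : ℂ) • (1 : Op (TorusSite d L) 2) + siteSpin 1 x 2)) =
      (leftUniformField L j a ⊗ₖ (1 : Op (torusLeftHalf L j a) 2) +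
        (1 : Op (torusLeftHalf L j a) 2) ⊗ₖ leftUniformField L j a).submatrix
        (torusSplit L j a hL) (torusSplit L j a hL) := by
    have hu := uniformField_eq_embed (j := j) (a := a) hL 1 (((1 / 2 : ℝ)) : ℂ) 2 (d := d) (L := L)
    rw [h12] at hu
    rw [hu, leftUniformField, h12, torusLeftEmbed_apply, torusRightEmbed_apply, submatrix_add]
    rfl
  have hK : xyRealFieldHamiltonian L 1 (0 : TorusSite d L → ℝ) =
      (xyLeftHamiltonian L j a hL 1 0 ⊗ₖ 1 + 1 ⊗ₖ xyLeftHamiltonian L j a hL 1 0 -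
        ∑ i, xyCrossOp L j a hL 1 0 i ⊗ₖ xyCrossOp L j a hL 1 0 i).submatrix
        (torusSplit L j a hL) (torusSplit L j a hL) :=
    xyRealFieldHamiltonian_eq_submatrix L j a hL 1 0
  rw [hK, hU, ← submatrix_smul', ← submatrix_add', kroneckerForm_add_smul_field]

end Kronecker

/-! ## §4 The absolute ground state is at half filling (T = 0) -/

section Transport

variable {ι p : Type*} [Fintype ι] [DecidableEq ι] [Fintype p] [DecidableEq p]

/-- Ground energies along `W H Wᴴ = K|_e`: `E₀(H) = E₀(K)` (unitary invariance of the spectrum;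
the transport used in [AizenmanEtAl2004] App. A between `H` and `H'`). [cite: AizenmanEtAl2004, Appendix A] -/
theorem groundEnergy_eq_of_conj_submatrix [Nonempty ι] {H W : Matrix ι ι ℂ} {K : Matrix p p ℂ}
    (e : ι ≃ p) (hK : K.IsHermitian) (hW : W * Wᴴ = 1) (hconj : W * H * Wᴴ = K.submatrix e e) :
    H.groundEnergy = K.groundEnergy := by
  haveI : Nonempty p := Nonempty.map e inferInstance
  have hU : W ∈ Matrix.unitaryGroup ι ℂ := Matrix.mem_unitaryGroup_iff.2 (by
    rw [star_eq_conjTranspose]; exact hW)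
  rw [← Matrix.groundEnergy_unitary_conj (A := H) hU, hconj, Matrix.groundEnergy_submatrix_equiv hK e]

/-- **Transport of an annihilated ground state** along a unitary `W` and a reindexing `e` with
`W H Wᴴ = K|_e`, `W S Wᴴ = Q|_e`: a ground-state vector `φ` of `K` with `Qφ = 0` yields the
ground-state vector `ψ = Wᴴ(φ ∘ e)` of `H` with `Sψ = 0` (the passage between `H`, `S` and `H'`, `S'`
of [AizenmanEtAl2004] App. A). [cite: AizenmanEtAl2004, Appendix A] -/
theorem exists_groundState_annihilated_of_conj_submatrix [Nonempty ι] {H S W : Matrix ι ι ℂ}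
    {K Q : Matrix p p ℂ} (e : ι ≃ p) (hK : K.IsHermitian) (hW : W * Wᴴ = 1) (hW' : Wᴴ * W = 1)
    (hconj : W * H * Wᴴ = K.submatrix e e) (hconjS : W * S * Wᴴ = Q.submatrix e e)
    {φ : p → ℂ} (hφ : φ ∈ K.groundSpace) (hφ0 : φ ≠ 0) (hQφ : Q *ᵥ φ = 0) :
    ∃ ψ : ι → ℂ, ψ ≠ 0 ∧ ψ ∈ H.groundSpace ∧ S *ᵥ ψ = 0 := by
  have hE := groundEnergy_eq_of_conj_submatrix e hK hW hconj
  set v : ι → ℂ := fun σ => φ (e σ) with hv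
  have hve : v ∘ e.symm = φ := by
    funext q; simp [hv]
  -- `X|_e v = (X φ) ∘ e`
  have hsub : ∀ X : Matrix p p ℂ, X.submatrix e e *ᵥ v = fun σ => (X *ᵥ φ) (e σ) := by
    intro X
    rw [submatrix_mulVec_equiv, hve]
    rfl
  -- `H = Wᴴ K|_e W`, `S = Wᴴ Q|_e W`
  have hback : ∀ {X : Matrix ι ι ℂ} {Y : Matrix p p ℂ}, W * X * Wᴴ = Y.submatrix e e →
      X = Wᴴ * Y.submatrix e e * W := by
    intro X Y h
    rw [← h]
    simp only [← Matrix.mul_assoc, hW', Matrix.one_mul]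
    rw [Matrix.mul_assoc, hW', Matrix.mul_one]
  -- `X Wᴴ = Wᴴ Y|_e`
  have hpush : ∀ {X : Matrix ι ι ℂ} {Y : Matrix p p ℂ}, W * X * Wᴴ = Y.submatrix e e →
      X * Wᴴ = Wᴴ * Y.submatrix e e := by
    intro X Y h
    rw [hback h, Matrix.mul_assoc, Matrix.mul_assoc, hW, Matrix.mul_one]
  refine ⟨Wᴴ *ᵥ v, ?_, ?_, ?_⟩
  · intro h0
    apply hφ0
    have h1 : W *ᵥ (Wᴴ *ᵥ v) = 0 := by rw [h0, mulVec_zero]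
    rw [mulVec_mulVec, hW, one_mulVec] at h1
    funext q
    have := congrFun h1 (e.symm q)
    simpa [hv] using this
  · rw [Matrix.mem_groundSpace_iff, mulVec_mulVec, hpush hconj, ← mulVec_mulVec, hsub,
      (Matrix.mem_groundSpace_iff K φ).1 hφ, hE, ← mulVec_smul]
    congr 1
  · rw [mulVec_mulVec, hpush hconjS, ← mulVec_mulVec, hsub, hQφ]
    exact mulVec_zero _

/-- If SOME ground-state vector of a Hermitian `A` lies in the subspace `K`, the sector energy of
`K` is the ground energy (variational principle). [cite: Tasaki2020, §2.1 eq. (2.1.6)] -/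
theorem minEnergyOn_eq_groundEnergy_of_mem [Nonempty ι] {A : Matrix ι ι ℂ} (hA : A.IsHermitian)
    {K : Submodule ℂ (ι → ℂ)} {ψ : ι → ℂ} (hψ : ψ ∈ A.groundSpace) (hψ0 : ψ ≠ 0) (hψK : ψ ∈ K) :
    A.minEnergyOn K = A.groundEnergy := by
  have hAψ := (Matrix.mem_groundSpace_iff A ψ).1 hψ
  obtain ⟨c, -, hc1⟩ := exists_smul_unit hψ0
  have hmemK : c • ψ ∈ K := K.smul_mem c hψK
  have hray : (star (c • ψ) ⬝ᵥ A *ᵥ (c • ψ)).re = A.groundEnergy := by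
    rw [mulVec_smul, hAψ, smul_comm, dotProduct_smul, hc1, smul_eq_mul, mul_one, Complex.ofReal_re]
  refine le_antisymm ?_ ?_
  · have h := minEnergyOn_le_rayleigh_of_mem hA K hmemK hc1
    rwa [hray] at h
  · refine le_csInf ⟨_, c • ψ, hmemK, hc1, rfl⟩ ?_
    rintro E ⟨φ, -, hφ1, rfl⟩
    exact Matrix.groundEnergy_le_rayleigh_holds hA φ hφ1

end Transport

/-! ### Commutation with the particle number -/

omit [NeZero L] in
/-- **`U(1)` symmetry of the XXZ Hamiltonian**: `[H_XXZ, S³_tot] = 0` on any graph (each bond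
`S¹S¹ + S²S² + ΔS³S³ = (𝐒_x·𝐒_y - S³_xS³_y) + ΔS³_xS³_y`, and `𝐒_x·𝐒_y`, `S³_xS³_y` commute with
`S³_tot`, `commute_sum_siteSpin_mul_siteSpin_totalSpin`). Tasaki (2020) §2.5.
[cite: Tasaki2020, §2.5 eq. (2.5.2)] -/
theorem commute_xxzHamiltonian_totalSpin_two {Λ : Type*} [Fintype Λ] [DecidableEq Λ] (n : ℕ)
    (G : SimpleGraph Λ) [DecidableRel G.Adj] (J Δ : ℝ) :
    Commute (xxzHamiltonian n G J Δ) (totalSpin n 2) := by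
  have hz : ∀ x : Λ, Commute (siteSpin n x 2) (totalSpin n 2 : Op Λ (n + 1)) := by
    intro x
    have h := siteSpin_mul_totalSpin n x 2 2
    rw [Ring.lie_def, sub_self, onSite_zero, add_zero] at h
    exact h
  rw [xxzHamiltonian]
  refine Commute.smul_left (Commute.sum_left _ _ _ fun e _ => ?_) _
  induction e using Sym2.ind with
  | h x y =>
    simp only [Sym2.lift_mk]
    have hP := commute_sum_siteSpin_mul_siteSpin_totalSpin n x y 2
    have hP' := commute_sum_siteSpin_mul_siteSpin_totalSpin n y x 2
    have hZ : Commute (siteSpin n x 2 * siteSpin n y 2) (totalSpin n 2 : Op Λ (n + 1)) :=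
      (hz x).mul_left (hz y)
    have hZ' : Commute (siteSpin n y 2 * siteSpin n x 2) (totalSpin n 2 : Op Λ (n + 1)) :=
      (hz y).mul_left (hz x)
    have hterm : spinBond n 0 x y + spinBond n 1 x y + (Δ : ℂ) • spinBond n 2 x y =
        (1 / 2 : ℂ) • ((∑ α : Fin 3, siteSpin n x α * siteSpin n y α) - siteSpin n x 2 * siteSpin n y 2 +
          ((∑ α : Fin 3, siteSpin n y α * siteSpin n x α) - siteSpin n y 2 * siteSpin n x 2)) +
        ((Δ : ℂ) * (1 / 2 : ℂ)) • (siteSpin n x 2 * siteSpin n y 2 + siteSpin n y 2 * siteSpin n x 2) := by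
      simp only [spinBond, Fin.sum_univ_three]
      module
    rw [hterm]
    exact ((((hP.sub_left hZ).add_left (hP'.sub_left hZ')).smul_left _).add_left
      ((hZ.add_left hZ').smul_left _))

/-- **`U(1)` symmetry of the hard-core lattice gas** in every staggered field:
`[H, S³_tot] = 0`, i.e. the particle number `N = S³_tot + |Λ|/2` is conserved.
[cite: LSSY2005, Ch. 11 §11.1] -/
theorem commute_hardCoreLatticeGas_totalSpin (lam : ℝ) :
    Commute (hardCoreLatticeGas d L lam) (totalSpin 1 2) := by
  have hz : ∀ x : TorusSite d L, Commute (siteSpin 1 x 2) (totalSpin 1 2 : Op (TorusSite d L) 2) := by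
    intro x
    have h := siteSpin_mul_totalSpin 1 x 2 2
    rw [Ring.lie_def, sub_self, onSite_zero, add_zero] at h
    exact h
  rw [hardCoreLatticeGas_eq]
  refine (commute_xxzHamiltonian_totalSpin_two 1 (torusGraph d L) (-1) 0).add_left
    (Commute.smul_left (Commute.sum_left _ _ _ fun x _ => ?_) _)
  exact ((Commute.one_left _).smul_left _).add_left ((hz x).smul_left _)

/-! ### The theorem at zero temperature -/

/-- `F` of the left half is real symmetric. [cite: LSSY2005, Ch. 11 (11.13)] -/
theorem leftUniformField_transpose {j : Fin d} {a : ZMod L} :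
    (leftUniformField L j a)ᵀ = leftUniformField L j a := by
  rw [leftUniformField, uniformField_transpose_eq 1 (1 / 2), (uniformField_isHermitian 1 (1 / 2)).eq]

omit [NeZero L] in
/-- Reindexing along an equivalence is injective on square matrices. [folklore] -/
private theorem eq_of_submatrix_equiv_eq {p q : Type*} {A B : Matrix q q ℂ} (e : p ≃ q)
    (h : A.submatrix e e = B.submatrix e e) : A = B := by
  have h' := congrArg (fun X : Matrix p p ℂ => X.submatrix e.symm e.symm) h
  simpa only [submatrix_submatrix, Equiv.self_comp_symm, submatrix_id_id] using h'

/-- **The absolute ground state of the hard-core lattice gas is at half filling** (T = 0 part of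
[AizenmanEtAl2004] Appendix A: "the absolute ground state energy of `H` is obtained when the
particle number is `|Λ|/2`", there with uniqueness; [LSSY2005] App. to Ch. 11): on the even torus
`(ℤ/Lℤ)^d` (`d ≥ 1`, `L ≥ 4` even), for EVERY staggered field `λ`, the Hamiltonian
`hardCoreLatticeGas d L λ` has a ground-state vector annihilated by `S³_tot = N - |Λ|/2`.
Proof: after the sublattice rotation the Hamiltonian is the reflection-symmetric real Kronecker
form `(A+λF)⊗1 + 1⊗(A+λF) - ΣMᵢ⊗Mᵢ` and `S³_tot` becomes `F_ε⊗1 - 1⊗F_ε`; the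
Dyson–Lieb–Simon / Kennedy–Lieb–Shastry positive ground state `vec c`, `c ⪰ 0`, overlaps the
canonical vector `vec 1`, which the charge annihilates, and projecting `vec 1` onto the ground space
gives the annihilated ground state (`Matrix.liebSchupp_exists_groundState_annihilated`).
(Uniqueness — the Perron–Frobenius part of the printed statement — is not asserted here.)
[cite: AizenmanEtAl2004, Appendix A] [cite: LSSY2005, Ch. 11 §11.2] -/
theorem exists_groundState_totalSpin_eq_zero (hd : 0 < d) (hL : Even L) (lam : ℝ) :
    ∃ ψ : TensorIndex (TorusSite d L) 2 → ℂ, ψ ≠ 0 ∧ ψ ∈ (hardCoreLatticeGas d L lam).groundSpace ∧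
      totalSpin 1 2 *ᵥ ψ = 0 := by
  have h2 : 2 ∣ L := even_iff_two_dvd.1 hL
  set j : Fin d := ⟨0, hd⟩ with hj
  set a : ZMod L := 0 with ha
  set e := torusSplit (q := 2) L j a hL with he
  set W := sublatticeFlip (d := d) L with hWdef
  set A := xyLeftHamiltonian L j a hL 1 0 + (lam : ℂ) • leftUniformField L j a with hA
  set M := xyCrossOp L j a hL 1 0 with hM
  set Fs := leftStagSpin L j a with hFs
  have hW : W * Wᴴ = 1 := sublatticeFlip_mul_conjTranspose
  have hW' : Wᴴ * W = 1 := sublatticeFlip_conjTranspose_mul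
  have hconj : W * hardCoreLatticeGas d L lam * Wᴴ =
      (A ⊗ₖ (1 : Op (torusLeftHalf L j a) 2) + (1 : Op (torusLeftHalf L j a) 2) ⊗ₖ A -
        ∑ i, M i ⊗ₖ M i).submatrix e e := by
    rw [hWdef, sublatticeFlip_conj_hardCoreLatticeGas h2 lam, rotated_eq_submatrix (hL := hL)]
  have hconjS : W * totalSpin 1 2 * Wᴴ =
      (Fs ⊗ₖ (1 : Op (torusLeftHalf L j a) 2) + (1 : Op (torusLeftHalf L j a) 2) ⊗ₖ (-Fs)).submatrix
        e e := by
    rw [hWdef, sublatticeFlip_conj_totalSpin, stagSpin_eq_submatrix (hL := hL)]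
  -- Hermiticity of the Kronecker form
  have hH := hardCoreLatticeGas_isHermitian d L lam
  have hK : (A ⊗ₖ (1 : Op (torusLeftHalf L j a) 2) + (1 : Op (torusLeftHalf L j a) 2) ⊗ₖ A -
      ∑ i, M i ⊗ₖ M i).IsHermitian := by
    have h := (Matrix.isHermitian_mul_mul_conjTranspose W hH).submatrix e.symm
    rw [hconj, submatrix_submatrix, Equiv.self_comp_symm, submatrix_id_id] at h
    exact h
  -- commutation in Kronecker coordinates
  have hprod : ∀ X Y : Op (TorusSite d L) 2, W * (X * Y) * Wᴴ = W * X * Wᴴ * (W * Y * Wᴴ) := by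
    intro X Y
    calc W * (X * Y) * Wᴴ = W * (X * (Wᴴ * W) * Y) * Wᴴ := by rw [hW', Matrix.mul_one]
      _ = W * X * Wᴴ * (W * Y * Wᴴ) := by simp only [Matrix.mul_assoc]
  have hcomm : (Fs ⊗ₖ (1 : Op (torusLeftHalf L j a) 2) + (1 : Op (torusLeftHalf L j a) 2) ⊗ₖ (-Fs)) *
      (A ⊗ₖ (1 : Op (torusLeftHalf L j a) 2) + (1 : Op (torusLeftHalf L j a) 2) ⊗ₖ A - ∑ i, M i ⊗ₖ M i) =
      (A ⊗ₖ (1 : Op (torusLeftHalf L j a) 2) + (1 : Op (torusLeftHalf L j a) 2) ⊗ₖ A - ∑ i, M i ⊗ₖ M i) *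
      (Fs ⊗ₖ (1 : Op (torusLeftHalf L j a) 2) + (1 : Op (torusLeftHalf L j a) 2) ⊗ₖ (-Fs)) := by
    refine eq_of_submatrix_equiv_eq e ?_
    rw [← submatrix_mul_equiv (e₂ := e), ← submatrix_mul_equiv (e₂ := e), ← hconj, ← hconjS, ← hprod,
      ← hprod, (commute_hardCoreLatticeGas_totalSpin (d := d) (L := L) lam).eq]
  -- realness
  have hAt : Aᵀ = A := by
    rw [hA, transpose_add, transpose_smul, xyLeftHamiltonian_transpose, leftUniformField_transpose]
  have hMt : ∀ i, (M i)ᵀ = (M i)ᴴ := fun i => xyCrossOp_transpose_eq L j a 1 hL 0 i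
  have hXY : ∀ _ : Unit, (-Fs)ᵀ = -Fs := fun _ => by rw [transpose_neg, hFs, leftStagSpin_transpose]
  haveI : Nonempty (torusLeftHalf L j a → Fin (1 + 1)) := ⟨fun _ => 0⟩
  obtain ⟨φ, hφ, hφ0, hQφ⟩ := Matrix.liebSchupp_exists_groundState_annihilated A M hAt hMt hK
    (fun _ : Unit => Fs) (fun _ : Unit => -Fs) hXY (fun _ => hcomm)
  exact exists_groundState_annihilated_of_conj_submatrix e hK hW hW' hconj hconjS hφ hφ0 (hQφ ())

/-- **Half filling realises the ground energy**: the lowest energy in the magnetisation sector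
`S³_tot = 0` (particle number `N = |Λ|/2`) equals the absolute ground-state energy of the
hard-core lattice gas, for every staggered field `λ` ([AizenmanEtAl2004] App. A; `λ = 0`:
[Mattis1979] as cited there). [cite: AizenmanEtAl2004, Appendix A] -/
theorem lowestEnergyInSector_zero_eq_groundEnergy (hd : 0 < d) (hL : Even L) (lam : ℝ) :
    lowestEnergyInSector 1 (hardCoreLatticeGas d L lam) 0 = (hardCoreLatticeGas d L lam).groundEnergy := by
  obtain ⟨ψ, hψ0, hψ, hS⟩ := exists_groundState_totalSpin_eq_zero hd hL lam
  refine minEnergyOn_eq_groundEnergy_of_mem (hardCoreLatticeGas_isHermitian d L lam) hψ hψ0 ?_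
  rw [spinZSector, Module.End.mem_eigenspace_iff, Matrix.toLin'_apply, hS, Complex.ofReal_zero, zero_smul]

/-- **Every other particle number costs at least as much**: `E₀ = E(0) ≤ E(M)` for every
nonempty magnetisation sector `M` — the ground-state energy of the hard-core lattice gas as a
function of the particle number is minimal at half filling. [cite: AizenmanEtAl2004, Appendix A] -/
theorem lowestEnergyInSector_zero_le (hd : 0 < d) (hL : Even L) (lam M : ℝ)
    (hM : spinZSector (Λ := TorusSite d L) 1 M ≠ ⊥) :
    lowestEnergyInSector 1 (hardCoreLatticeGas d L lam) 0 ≤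
      lowestEnergyInSector 1 (hardCoreLatticeGas d L lam) M := by
  rw [lowestEnergyInSector_zero_eq_groundEnergy hd hL lam, lowestEnergyInSector]
  obtain ⟨v, hv, hv0⟩ := (Submodule.ne_bot_iff _).1 hM
  obtain ⟨c, -, hc1⟩ := exists_smul_unit hv0
  refine le_csInf ⟨_, c • v, (spinZSector 1 M).smul_mem c hv, hc1, rfl⟩ ?_
  rintro E ⟨φ, -, hφ1, rfl⟩
  exact Matrix.groundEnergy_le_rayleigh_holds (hardCoreLatticeGas_isHermitian d L lam) φ hφ1

/-- **Boson language**: the particle number `N = Σ_x n_x = S³_tot + |Λ|/2`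
(`HardCoreBoson.num_eq`). [cite: MatsubaraMatsuda1956, §2] -/
theorem sum_num_eq_totalSpin_add :
    (∑ x : TorusSite d L, num x) = totalSpin 1 2 +
      ((Fintype.card (TorusSite d L) : ℂ) / 2) • (1 : Op (TorusSite d L) 2) := by
  calc (∑ x : TorusSite d L, num x)
      = ∑ x : TorusSite d L, (siteSpin 1 x 2 + (1 / 2 : ℂ) • (1 : Op (TorusSite d L) 2)) :=
        Finset.sum_congr rfl fun x _ => num_eq x
    _ = totalSpin 1 2 + ∑ _x : TorusSite d L, (1 / 2 : ℂ) • (1 : Op (TorusSite d L) 2) := by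
        rw [Finset.sum_add_distrib, totalSpin]
    _ = _ := by
        rw [Finset.sum_const, Finset.card_univ, ← Nat.cast_smul_eq_nsmul ℂ, smul_smul, mul_one_div]

/-- **Hard-core bosons: the ground state is at half filling** (boson form of
`exists_groundState_totalSpin_eq_zero`): for the hard-core lattice Bose gas with hopping `½` and
ANY staggered potential `λ(-1)^x n_x` on the even torus there is a ground-state vector with exactly
`|Λ|/2` particles, `N ψ = (|Λ|/2) ψ`. [cite: AizenmanEtAl2004, Appendix A] -/
theorem exists_groundState_halfFilling (hd : 0 < d) (hL : Even L) (lam : ℝ) :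
    ∃ ψ : TensorIndex (TorusSite d L) 2 → ℂ, ψ ≠ 0 ∧ ψ ∈ (hardCoreLatticeGas d L lam).groundSpace ∧
      (∑ x : TorusSite d L, num x) *ᵥ ψ = ((Fintype.card (TorusSite d L) : ℂ) / 2) • ψ := by
  obtain ⟨ψ, hψ0, hψ, hS⟩ := exists_groundState_totalSpin_eq_zero hd hL lam
  refine ⟨ψ, hψ0, hψ, ?_⟩
  rw [sum_num_eq_totalSpin_add, add_mulVec, hS, zero_add, smul_mulVec, one_mulVec]

/-! ## §5 Magnetisation (particle-number) sectors and their partition functions -/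

section Sectors

variable {Λ : Type*} [Fintype Λ] [DecidableEq Λ]

/-- Twice the magnetisation of a basis configuration, `Σ_x (1 - 2σ_x) ∈ ℤ` — the eigenvalue of
`2S³_tot` on the basis state `σ` (spin up `σ_x = 0 ↦ +1`, down `σ_x = 1 ↦ -1`); in boson language
`2N - |Λ|`. [cite: AizenmanEtAl2004, Appendix A] -/
def twiceMagnetization (σ : TensorIndex Λ 2) : ℤ := ∑ x, (1 - 2 * ((σ x : ℕ) : ℤ))

/-- The projection onto the magnetisation sector `2S³_tot = m` (particle number
`N = (|Λ| + m)/2`): diagonal in the occupation basis. [cite: AizenmanEtAl2004, Appendix A] -/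
def sectorProj (m : ℤ) : Op Λ 2 := diagonal fun σ => if twiceMagnetization σ = m then 1 else 0

/-- The **canonical (sector) partition function** `Z(m) = Tr 𝒫_m e^{-βH}`, `𝒫_m` the projection onto
`2S³_tot = m` ([AizenmanEtAl2004] App. A, "Z(m) = Tr 𝒫_m exp(-βH)"). [cite: AizenmanEtAl2004, Appendix A] -/
def sectorPartitionFn (β : ℝ) (H : Op Λ 2) (m : ℤ) : ℝ :=
  ((sectorProj m * gibbsWeight β H).trace).re

/-- `S³_x` acts diagonally: `S³_x = diag(½ - σ_x)`. [cite: Tasaki2020, §2.1 eq. (2.1.5)] -/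
theorem siteSpin_two_eq_diagonal (x : Λ) :
    (siteSpin 1 x 2 : Op Λ 2) = diagonal fun σ => (1 / 2 : ℂ) - ((σ x : ℕ) : ℂ) := by
  ext σ τ
  rw [siteSpin, spinVec_two, onSite_apply, diagonal_apply, SpinOperators.spinZ, diagonal_apply]
  by_cases h : σ = τ
  · subst h
    simp
  · rw [if_neg h]
    by_cases hx : σ x = τ x
    · have : ¬ ∀ y, y ≠ x → σ y = τ y := by
        intro hall
        exact h (funext fun y => if hy : y = x then hy ▸ hx else hall y hy)
      rw [if_neg this]
    · rw [if_neg hx]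
      split_ifs <;> simp

/-- **`2S³_tot` is the diagonal matrix of twice-magnetisations.** [cite: Tasaki2020, §2.2 eq. (2.2.11)] -/
theorem two_smul_totalSpin_two_eq_diagonal :
    (2 : ℂ) • (totalSpin 1 2 : Op Λ 2) = diagonal fun σ => ((twiceMagnetization σ : ℤ) : ℂ) := by
  ext σ τ
  rw [Matrix.smul_apply, totalSpin, Matrix.sum_apply, diagonal_apply]
  simp only [siteSpin_two_eq_diagonal, diagonal_apply]
  by_cases h : σ = τ
  · subst h
    simp only [if_true, smul_eq_mul, Finset.mul_sum, twiceMagnetization, Int.cast_sum, Int.cast_sub,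
      Int.cast_one, Int.cast_mul, Int.cast_ofNat, Int.cast_natCast]
    refine Finset.sum_congr rfl fun x _ => ?_
    ring
  · simp only [if_neg h, Finset.sum_const_zero, smul_zero]

/-- `𝒫_m` keeps the amplitudes of the configurations of magnetisation `m` and kills the others.
[cite: AizenmanEtAl2004, Appendix A] -/
theorem sectorProj_mulVec (m : ℤ) (v : TensorIndex Λ 2 → ℂ) :
    sectorProj m *ᵥ v = fun σ => if twiceMagnetization σ = m then v σ else 0 := by
  funext σ
  rw [sectorProj, mulVec_diagonal]
  split_ifs <;> simp

/-- **The range of `𝒫_m` lies in the sector `2S³_tot = m`** (particle number `N = (|Λ| + m)/2`).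
[cite: AizenmanEtAl2004, Appendix A] -/
theorem two_smul_totalSpin_mulVec_of_sectorProj (m : ℤ) {v : TensorIndex Λ 2 → ℂ}
    (hv : sectorProj m *ᵥ v = v) :
    ((2 : ℂ) • (totalSpin 1 2 : Op Λ 2)) *ᵥ v = (m : ℂ) • v := by
  rw [two_smul_totalSpin_two_eq_diagonal]
  funext σ
  rw [mulVec_diagonal, Pi.smul_apply, smul_eq_mul]
  have hσ := congrFun hv σ
  rw [sectorProj_mulVec] at hσ
  by_cases hm : twiceMagnetization σ = m
  · rw [hm]
  · simp only [hm, if_false] at hσ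
    rw [← hσ, mul_zero, mul_zero]

end Sectors

/-! ### The rotated sectors: staggered magnetisation -/

section StagSectors

variable (L)

/-- Twice the STAGGERED magnetisation `Σ_x ε_x (1 - 2σ_x)` of a configuration (the eigenvalue of
`W (2S³_tot) Wᴴ = 2Σ_x ε_x S³_x`). [cite: AizenmanEtAl2004, Appendix A] -/
def twiceStagMagnetization (σ : TensorIndex (TorusSite d L) 2) : ℤ :=
  ∑ x, (if torusParity L x = 1 then -1 else 1) * (1 - 2 * ((σ x : ℕ) : ℤ))

/-- The projection onto the staggered sector `2Σ_x ε_x S³_x = m`. [cite: AizenmanEtAl2004, Appendix A] -/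
def stagSectorProj (m : ℤ) : Op (TorusSite d L) 2 :=
  diagonal fun σ => if twiceStagMagnetization L σ = m then 1 else 0

/-- The action of the sublattice rotation on configurations: flip the spins of the odd
sublattice. [cite: FrohlichLieb1978, eq. (1.4a)] -/
def flipOdd (σ : TensorIndex (TorusSite d L) 2) : TensorIndex (TorusSite d L) 2 :=
  fun x => if torusParity L x = 1 then Fin.rev (σ x) else σ x

variable {L}

omit [NeZero L] in
/-- `flipOdd` is an involution. [folklore] -/
private theorem flipOdd_flipOdd (σ : TensorIndex (TorusSite d L) 2) : flipOdd L (flipOdd L σ) = σ := by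
  funext x
  by_cases hx : torusParity L x = 1
  · simp only [flipOdd, if_pos hx, Fin.rev_rev]
  · simp only [flipOdd, if_neg hx]

omit [NeZero L] in
/-- `σˣ` is the flip: `σˣ_{ab} = [b = ā]`. [folklore] -/
private theorem spinHalfPauli_zero_apply (a b : Fin 2) :
    spinHalfPauli 0 a b = if b = Fin.rev a then 1 else 0 := by
  fin_cases a <;> fin_cases b <;> rfl

/-- **The sublattice rotation is a permutation matrix**: `W_{στ} = [τ = flipOdd σ]`.
[cite: FrohlichLieb1978, eq. (1.4a)] -/
theorem sublatticeFlip_apply (σ τ : TensorIndex (TorusSite d L) 2) :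
    sublatticeFlip (d := d) L σ τ = if τ = flipOdd L σ then 1 else 0 := by
  rw [sublatticeFlip, productOp_apply]
  have hfac : ∀ x : TorusSite d L,
      (if torusParity L x = 1 then spinHalfPauli 0 else (1 : Matrix (Fin 2) (Fin 2) ℂ)) (σ x) (τ x) =
        if τ x = flipOdd L σ x then 1 else 0 := by
    intro x
    by_cases hx : torusParity L x = 1
    · rw [if_pos hx, spinHalfPauli_zero_apply, flipOdd, if_pos hx]
    · rw [if_neg hx, one_apply, flipOdd, if_neg hx]
      simp only [eq_comm]
  simp only [hfac, Finset.prod_boole]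
  congr 1
  simp only [funext_iff, Finset.mem_univ, true_imp_iff]

/-- **Conjugating a diagonal matrix by the sublattice rotation** permutes its entries by `flipOdd`.
[cite: FrohlichLieb1978, eq. (1.4a)] -/
theorem sublatticeFlip_conj_diagonal (v : TensorIndex (TorusSite d L) 2 → ℂ) :
    sublatticeFlip (d := d) L * diagonal v * (sublatticeFlip (d := d) L)ᴴ =
      diagonal fun σ => v (flipOdd L σ) := by
  ext σ τ
  rw [Matrix.mul_apply, diagonal_apply]
  have hentry : ∀ ρ : TensorIndex (TorusSite d L) 2,
      (sublatticeFlip (d := d) L * diagonal v) σ ρ * (sublatticeFlip (d := d) L)ᴴ ρ τ =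
        if ρ = flipOdd L σ then (if ρ = flipOdd L τ then v ρ else 0) else 0 := by
    intro ρ
    rw [mul_diagonal, conjTranspose_apply, sublatticeFlip_apply, sublatticeFlip_apply]
    by_cases h1 : ρ = flipOdd L σ <;> by_cases h2 : ρ = flipOdd L τ <;> simp [h1, h2]
  simp only [hentry, Finset.sum_ite_eq', Finset.mem_univ, if_true]
  by_cases h : σ = τ
  · subst h; simp
  · rw [if_neg h, if_neg]
    intro h'
    exact h (by rw [← flipOdd_flipOdd σ, h', flipOdd_flipOdd])

/-- Flipping the odd spins turns the magnetisation into the staggered magnetisation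
([AizenmanEtAl2004] App. A: the unitary "will change `Σ_x S³_x` to `S' = S ⊗ I - I ⊗ S`").
[cite: AizenmanEtAl2004, Appendix A] -/
theorem twiceMagnetization_flipOdd (σ : TensorIndex (TorusSite d L) 2) :
    twiceMagnetization (flipOdd L σ) = twiceStagMagnetization L σ := by
  unfold twiceMagnetization twiceStagMagnetization flipOdd
  refine Finset.sum_congr rfl fun x _ => ?_
  by_cases hx : torusParity L x = 1
  · rw [if_pos hx, if_pos hx, Fin.val_rev]
    have : (σ x : ℕ) < 2 := (σ x).isLt
    omega
  · rw [if_neg hx, if_neg hx, one_mul]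

/-- **The rotated sector projections**: `W 𝒫_m Wᴴ = 𝒫'_m`, the projection onto the staggered
sector ([AizenmanEtAl2004] App. A: "the unitary … will take `𝒫_m` into the operator
`𝒫'_m = Σ_n P_n ⊗ P_{n-m}`"). [cite: AizenmanEtAl2004, Appendix A] -/
theorem sublatticeFlip_conj_sectorProj (m : ℤ) :
    sublatticeFlip (d := d) L * sectorProj m * (sublatticeFlip (d := d) L)ᴴ = stagSectorProj L m := by
  rw [sectorProj, sublatticeFlip_conj_diagonal, stagSectorProj]
  simp only [twiceMagnetization_flipOdd]

end StagSectors

/-! ### The staggered sectors along a pair of planes: `𝒫'_m = Σ_n P_n ⊗ P_{n-m}` -/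

section ThermalKronecker

variable (L) (j : Fin d) (a : ZMod L)

/-- Twice the staggered magnetisation of a configuration of the LEFT half,
`G(τ) = Σ_{s ∈ Λ_L} ε_s (1 - 2τ_s)` (the eigenvalue of `2F_ε`). [cite: AizenmanEtAl2004, Appendix A] -/
def leftStagWeight (τ : TensorIndex (torusLeftHalf L j a) 2) : ℤ :=
  ∑ s : torusLeftHalf L j a, (if torusParity L (s : TorusSite d L) = 1 then -1 else 1) * (1 - 2 * ((τ s : ℕ) : ℤ))

/-- The projection `P_n` onto the configurations of the left half with `G(τ) = n` ("`P_n` is the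
projection … onto the eigenspace of `S` with eigenvalue `n` … a real matrix").
[cite: AizenmanEtAl2004, Appendix A] -/
def leftSectorProj (n : ℤ) : Op (torusLeftHalf L j a) 2 :=
  diagonal fun τ => if leftStagWeight L j a τ = n then 1 else 0

variable {L j a}

/-- `|G(τ)| ≤ |Λ_L|`. [folklore] -/
private theorem abs_leftStagWeight_le (τ : TensorIndex (torusLeftHalf L j a) 2) :
    |leftStagWeight L j a τ| ≤ Fintype.card (torusLeftHalf L j a) := by
  unfold leftStagWeight
  calc |∑ s : torusLeftHalf L j a, (if torusParity L (s : TorusSite d L) = 1 then -1 else 1) * (1 - 2 * ((τ s : ℕ) : ℤ))|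
      ≤ ∑ s : torusLeftHalf L j a, |(if torusParity L (s : TorusSite d L) = 1 then -1 else 1) * (1 - 2 * ((τ s : ℕ) : ℤ))| :=
        Finset.abs_sum_le_sum_abs _ _
    _ ≤ ∑ _s : torusLeftHalf L j a, (1 : ℤ) := by
        refine Finset.sum_le_sum fun s _ => ?_
        have hlt : (τ s : ℕ) < 2 := (τ s).isLt
        rw [abs_mul]
        have h1 : |(if torusParity L (s : TorusSite d L) = 1 then -1 else 1 : ℤ)| = 1 := by
          split_ifs <;> simp
        rw [h1, one_mul, abs_le]
        constructor <;> omega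
    _ = Fintype.card (torusLeftHalf L j a) := by simp

/-- `P_n` is a real matrix. [cite: AizenmanEtAl2004, Appendix A] -/
theorem leftSectorProj_transpose_eq (n : ℤ) :
    (leftSectorProj L j a n)ᵀ = (leftSectorProj L j a n)ᴴ := by
  rw [leftSectorProj, diagonal_transpose, diagonal_conjTranspose]
  congr 1
  funext τ
  by_cases h : leftStagWeight L j a τ = n
  · simp [h]
  · simp [h]

/-- The staggered magnetisation splits along the planes: `g(σ) = G(σ_L) - G(σ_R)`, the right half
read through the reflection, which exchanges the sublattices. [cite: AizenmanEtAl2004, Appendix A] -/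
theorem twiceStagMagnetization_eq_sub (hL : Even L) (σ : TensorIndex (TorusSite d L) 2) :
    twiceStagMagnetization L σ = leftStagWeight L j a (torusSplit L j a hL σ).1 -
      leftStagWeight L j a (torusSplit L j a hL σ).2 := by
  have h2 : 2 ∣ L := even_iff_two_dvd.1 hL
  unfold twiceStagMagnetization leftStagWeight
  rw [sum_sites_split L j a hL]
  simp only [torusSplit_apply_fst, torusSplit_apply_snd]
  rw [← Finset.sum_coe_sort (torusLeftHalf L j a) (fun x : TorusSite d L =>
        (if torusParity L x = 1 then (-1 : ℤ) else 1) * (1 - 2 * ((σ x : ℕ) : ℤ))),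
    ← Finset.sum_coe_sort (torusLeftHalf L j a) (fun x : TorusSite d L =>
        (if torusParity L (Torus.reflectBetweenSites j a x) = 1 then (-1 : ℤ) else 1) *
          (1 - 2 * ((σ (Torus.reflectBetweenSites j a x) : ℕ) : ℤ))),
    sub_eq_add_neg, ← Finset.sum_neg_distrib]
  congr 1
  refine Finset.sum_congr rfl fun s _ => ?_
  rw [torusParity_reflectBetweenSites h2, ← neg_mul]
  congr 1
  have hcases : ∀ u : ZMod 2, (u = 1 ∧ ¬ (u + 1 = 1)) ∨ (¬ u = 1 ∧ u + 1 = 1) := by decide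
  rcases hcases (torusParity L (s : TorusSite d L)) with ⟨h1, h1'⟩ | ⟨h1, h1'⟩ <;> simp [h1, h1']

/-- **`𝒫'_m = Σ_n P_n ⊗ P_{n-m}`** along the planes ([AizenmanEtAl2004] App. A, the displayed formula
for `𝒫'_m`), for any finite index window `S ⊇ range G`. [cite: AizenmanEtAl2004, Appendix A] -/
theorem stagSectorProj_eq_submatrix (hL : Even L) (m : ℤ) (S : Finset ℤ)
    (hS : ∀ τ : TensorIndex (torusLeftHalf L j a) 2, leftStagWeight L j a τ ∈ S) :
    stagSectorProj L m =
      (∑ n ∈ S, leftSectorProj L j a n ⊗ₖ leftSectorProj L j a (n - m)).submatrix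
        (torusSplit L j a hL) (torusSplit L j a hL) := by
  ext σ σ'
  rw [stagSectorProj, diagonal_apply, submatrix_apply, Matrix.sum_apply]
  simp only [leftSectorProj, diagonal_kronecker_diagonal, diagonal_apply]
  by_cases h : σ = σ'
  · subst h
    simp only [if_true]
    rw [twiceStagMagnetization_eq_sub (j := j) (a := a) hL,
      Finset.sum_eq_single (leftStagWeight L j a (torusSplit L j a hL σ).1)]
    · simp only [if_true, one_mul]
      by_cases hm : leftStagWeight L j a (torusSplit L j a hL σ).1 -
          leftStagWeight L j a (torusSplit L j a hL σ).2 = m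
      · rw [if_pos hm, if_pos (by omega)]
      · rw [if_neg hm, if_neg (by omega)]
    · intro n _ hn
      rw [if_neg (Ne.symm hn), zero_mul]
    · intro habs
      exact absurd (hS _) habs
  · have hne : torusSplit L j a hL σ ≠ torusSplit L j a hL σ' := fun h' =>
      h ((torusSplit L j a hL).injective h')
    rw [if_neg h]
    simp only [if_neg hne, Finset.sum_const_zero]

/-- **The sector partition function in Kronecker form**: for `β ≥ 0`,
`Z(m) = Re Tr[(Σ_{n∈S} P_n ⊗ P_{n-m}) exp((-βA')⊗1 + 1⊗(-βA') + Σᵢ(√βMᵢ)⊗(√βMᵢ))]` with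
`A' = A + λF` — the insertion form to which `Matrix.trace_mul_exp_kroneckerSum_le` applies.
[cite: AizenmanEtAl2004, Appendix A (A.11)] [cite: LSSY2005, Ch. 11 (11.14)–(11.19)] -/
theorem sectorPartitionFn_eq_kronecker (hL : Even L) {β : ℝ} (hβ : 0 ≤ β) (lam : ℝ) (m : ℤ)
    (S : Finset ℤ) (hS : ∀ τ : TensorIndex (torusLeftHalf L j a) 2, leftStagWeight L j a τ ∈ S) :
    sectorPartitionFn β (hardCoreLatticeGas d L lam) m =
      ((∑ n ∈ S, leftSectorProj L j a n ⊗ₖ leftSectorProj L j a (n - m)) *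
        exp ((-(β : ℂ) • (xyLeftHamiltonian L j a hL 1 0 + (lam : ℂ) • leftUniformField L j a)) ⊗ₖ
            (1 : Op (torusLeftHalf L j a) 2) +
          (1 : Op (torusLeftHalf L j a) 2) ⊗ₖ
            (-(β : ℂ) • (xyLeftHamiltonian L j a hL 1 0 + (lam : ℂ) • leftUniformField L j a)) +
          ∑ i, ((Real.sqrt β : ℂ) • xyCrossOp L j a hL 1 0 i) ⊗ₖ
            ((Real.sqrt β : ℂ) • xyCrossOp L j a hL 1 0 i))).trace.re := by
  have h2 : 2 ∣ L := even_iff_two_dvd.1 hL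
  set e := torusSplit (q := 2) L j a hL with he
  set W := sublatticeFlip (d := d) L with hWdef
  set A := xyLeftHamiltonian L j a hL 1 0 + (lam : ℂ) • leftUniformField L j a with hA
  set M := xyCrossOp L j a hL 1 0 with hM
  set K := A ⊗ₖ (1 : Op (torusLeftHalf L j a) 2) + (1 : Op (torusLeftHalf L j a) 2) ⊗ₖ A -
    ∑ i, M i ⊗ₖ M i with hK
  have hW : W * Wᴴ = 1 := sublatticeFlip_mul_conjTranspose
  have hW' : Wᴴ * W = 1 := sublatticeFlip_conjTranspose_mul
  have hconj : W * hardCoreLatticeGas d L lam * Wᴴ = K.submatrix e e := by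
    rw [hWdef, sublatticeFlip_conj_hardCoreLatticeGas h2 lam, rotated_eq_submatrix (hL := hL)]
  have hprod : ∀ X Y : Op (TorusSite d L) 2, W * (X * Y) * Wᴴ = W * X * Wᴴ * (W * Y * Wᴴ) := by
    intro X Y
    calc W * (X * Y) * Wᴴ = W * (X * (Wᴴ * W) * Y) * Wᴴ := by rw [hW', Matrix.mul_one]
      _ = W * X * Wᴴ * (W * Y * Wᴴ) := by simp only [Matrix.mul_assoc]
  -- conjugating the Gibbs weight
  have hunit : IsUnit W := ⟨⟨W, Wᴴ, hW, hW'⟩, rfl⟩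
  have hinv : W⁻¹ = Wᴴ := Matrix.inv_eq_right_inv hW
  have hexp : W * gibbsWeight β (hardCoreLatticeGas d L lam) * Wᴴ = (exp (-(β : ℂ) • K)).submatrix e e := by
    rw [gibbsWeight, ← hinv, ← Matrix.exp_conj _ _ hunit, Matrix.mul_smul, Matrix.smul_mul, hinv, hconj,
      ← submatrix_smul', exp_submatrix_equiv]
  -- the trace
  have htr : (sectorProj m * gibbsWeight β (hardCoreLatticeGas d L lam)).trace =
      ((∑ n ∈ S, leftSectorProj L j a n ⊗ₖ leftSectorProj L j a (n - m)) * exp (-(β : ℂ) • K)).trace := by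
    calc (sectorProj m * gibbsWeight β (hardCoreLatticeGas d L lam)).trace
        = (W * (sectorProj m * gibbsWeight β (hardCoreLatticeGas d L lam)) * Wᴴ).trace := by
          rw [trace_mul_cycle, hW', Matrix.one_mul]
      _ = (stagSectorProj L m * (exp (-(β : ℂ) • K)).submatrix e e).trace := by
          rw [hprod, hWdef, sublatticeFlip_conj_sectorProj, ← hWdef, hexp]
      _ = _ := by
          rw [stagSectorProj_eq_submatrix (j := j) (a := a) hL m S hS, submatrix_mul_equiv,
            trace_submatrix_equiv]
  rw [sectorPartitionFn, htr, hK, neg_smul_kroneckerForm hβ A A M M]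

end ThermalKronecker

/-! ## §6 The canonical partition function is maximal at half filling (T > 0) -/

/-- The sector partition functions are nonnegative: `Z(m) = Σ_{σ : 2S³(σ) = m} (e^{-βH})_{σσ} ≥ 0`
(diagonal entries of the positive matrix `e^{-βH}`). [cite: AizenmanEtAl2004, Appendix A] -/
theorem sectorPartitionFn_nonneg (β : ℝ) {H : Op (TorusSite d L) 2} (hH : H.IsHermitian) (m : ℤ) :
    0 ≤ sectorPartitionFn β H m := by
  rw [sectorPartitionFn, sectorProj, trace, Complex.re_sum]
  refine Finset.sum_nonneg fun σ _ => ?_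
  rw [diag_apply, diagonal_mul]
  have hd : 0 ≤ gibbsWeight β H σ σ := (posDef_gibbsWeight β hH).posSemidef.diag_nonneg
  split_ifs
  · rw [one_mul]; exact (Complex.nonneg_iff.1 hd).1
  · rw [zero_mul, Complex.zero_re]

/-- **Aizenman–Lieb–Seiringer–Solovej–Yngvason, Appendix A (A.11): the canonical partition
function of the hard-core lattice gas is maximal at half filling.** On the even torus
`(ℤ/Lℤ)^d` (`d ≥ 1`), for every staggered field `λ`, every `β > 0` and every magnetisation
sector `m` (`2S³_tot = m`, i.e. particle number `N = (|Λ| + m)/2`),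
`Z(m) = Tr 𝒫_m e^{-βH} ≤ Z(0)`.  Proof as printed: after the sublattice rotation
`Z(m) = Tr[(Σ_n P_n ⊗ P_{n-m}) e^{-βK}]` with `K = A'⊗1 + 1⊗A' - ΣMᵢ⊗Mᵢ` real, and the
Dyson–Lieb–Simon trace inequality with this real insertion (`Matrix.trace_mul_exp_kroneckerSum_le`,
the Cauchy–Schwarz form of "`A_nA_{n-m} ≤ A_n²/2 + A_{n-m}²/2` … undo the calculation") bounds it by
`Z(0)^{1/2} Z(0)^{1/2}`. ("We do not prove that the maximum is obtained only at half-filling.")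
[cite: AizenmanEtAl2004, Appendix A (A.11)] -/
theorem sectorPartitionFn_le_halfFilling (hd : 0 < d) (hL : Even L) {β : ℝ} (hβ : 0 < β) (lam : ℝ)
    (m : ℤ) :
    sectorPartitionFn β (hardCoreLatticeGas d L lam) m ≤ sectorPartitionFn β (hardCoreLatticeGas d L lam) 0 := by
  set j : Fin d := ⟨0, hd⟩ with hj
  set a : ZMod L := 0 with ha
  -- the index window
  set B : ℤ := (Fintype.card (torusLeftHalf L j a) : ℤ) + |m| with hB
  set S : Finset ℤ := Finset.Icc (-B) B with hSdef
  have hGB : ∀ τ : TensorIndex (torusLeftHalf L j a) 2, |leftStagWeight L j a τ| ≤ B := fun τ =>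
    (abs_leftStagWeight_le τ).trans (by rw [hB]; linarith [abs_nonneg m])
  have hS : ∀ τ : TensorIndex (torusLeftHalf L j a) 2, leftStagWeight L j a τ ∈ S := fun τ => by
    rw [hSdef, Finset.mem_Icc]; exact abs_le.1 (hGB τ)
  have hS' : ∀ τ : TensorIndex (torusLeftHalf L j a) 2, leftStagWeight L j a τ ∈ S.image (· - m) := by
    intro τ
    rw [Finset.mem_image]
    refine ⟨leftStagWeight L j a τ + m, ?_, by ring⟩
    rw [hSdef, Finset.mem_Icc]
    have h1 := abs_le.1 (abs_leftStagWeight_le τ)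
    have h2 := le_abs_self m
    have h3 := neg_abs_le m
    constructor <;> linarith
  -- abbreviations
  set A' := -(β : ℂ) • (xyLeftHamiltonian L j a hL 1 0 + (lam : ℂ) • leftUniformField L j a) with hA'
  set M' := fun i => (Real.sqrt β : ℂ) • xyCrossOp L j a hL 1 0 i with hM'
  set D := leftSectorProj L j a with hD
  -- realness
  have hAt : A'ᵀ = A'ᴴ := by
    have h := transpose_eq_conjTranspose_ofReal_smul
      (transpose_eq_conjTranspose_add (xyLeftHamiltonian_transpose_eq L j a 1 hL 0)
        (transpose_eq_conjTranspose_ofReal_smul (uniformField_transpose_eq (Λ := torusLeftHalf L j a) 1 (1 / 2)) lam)) (-β)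
    rw [Complex.ofReal_neg] at h
    rw [hA', leftUniformField]
    exact h
  have hMt : ∀ i, (M' i)ᵀ = (M' i)ᴴ := fun i =>
    transpose_eq_conjTranspose_ofReal_smul (xyCrossOp_transpose_eq L j a 1 hL 0 i) _
  have hDt : ∀ n : ℤ, (D n)ᵀ = (D n)ᴴ := fun n => leftSectorProj_transpose_eq n
  haveI : Nonempty (torusLeftHalf L j a → Fin (1 + 1)) := ⟨fun _ => 0⟩
  -- Z(m) and the two Z(0)'s in Kronecker form
  have hZm := sectorPartitionFn_eq_kronecker (j := j) (a := a) hL hβ.le lam m S hS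
  have hZ0 := sectorPartitionFn_eq_kronecker (j := j) (a := a) hL hβ.le lam 0 S hS
  have hZ0' := sectorPartitionFn_eq_kronecker (j := j) (a := a) hL hβ.le lam 0 (S.image (· - m)) hS'
  simp only [sub_zero] at hZ0 hZ0'
  rw [Finset.sum_image (fun x _ y _ h => by simpa using h)] at hZ0'
  -- the trace inequality with insertion, over the index type `S`
  have hineq := Matrix.trace_mul_exp_kroneckerSum_le (κ := S) (A := A') (B := A') (M := M') (Nn := M')
    (P := fun k => D k) (Q := fun k => D (k - m)) hAt hAt hMt hMt (fun k => hDt k) (fun k => hDt (k - m))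
  simp only [Finset.sum_coe_sort S (fun k => D k ⊗ₖ D (k - m)), Finset.sum_coe_sort S (fun k => D k ⊗ₖ D k),
    Finset.sum_coe_sort S (fun k => D (k - m) ⊗ₖ D (k - m))] at hineq
  rw [hD] at hineq
  rw [← hZm, ← hZ0, ← hZ0'] at hineq
  have h0 : 0 ≤ sectorPartitionFn β (hardCoreLatticeGas d L lam) 0 :=
    sectorPartitionFn_nonneg β (hardCoreLatticeGas_isHermitian d L lam) 0
  calc sectorPartitionFn β (hardCoreLatticeGas d L lam) m
      ≤ Real.sqrt (sectorPartitionFn β (hardCoreLatticeGas d L lam) 0) *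
          Real.sqrt (sectorPartitionFn β (hardCoreLatticeGas d L lam) 0) := hineq
    _ = sectorPartitionFn β (hardCoreLatticeGas d L lam) 0 := Real.mul_self_sqrt h0

end HardCoreBoson

end Literature.MathematicalPhysics.QuantumLattice

end
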